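import Summits.AtomisticToContinuum.HydrodynamicLimit.Theses.AntiMazurCoboundaries
import Literature.MathematicalPhysics.KineticTheory.BackwardCluster
import HarnessLib

/-!
# Objects of the crux line `true-anchored-infection` (crux `InfluenceLocality`,
# stmt-AtomisticToContinuum-13916; route AntiMazurCoboundaries)

Objects module of the registered skeleton
`Cruxes/InfluenceLocality/Lines/true_anchored_infection.lean` (lead
`prover-line-stmt-AtomisticToContinuum-13916-0`), moved VERBATIM into an importable `Theorems` module so
that the stub helper files of the line (one per registered stub, `--supports stmt-AtomisticToContinuum-13916`)
and the eventual closing file share ONE copy of them: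

* § 1 the frame of the crux, named: `ell` (`ℓ = (N+1)^{-1/3}`), `G3`, `Flow`, `ClusterFlows`, `Phase`,
  `IsBad` / `badCount` (verbatim the crux's predicate and `Finset.card`), `gibbs` (verbatim the crux's
  measure `localGibbsLaw σ a u₀ θ`), `Bound`, and the read-back `influenceLocality_iff` (`Iff.rfl`);
* § 2 the events of the line at rational grid times: `IsHot` (true side, relative speed cap `u` in the
  halo of `i`), `forecastWorld` (the isolated evolution of the range cluster of `i`), `IsForecastHot`,
  `IsGathering` (forecast backward cluster larger than `M`, `KineticTheory.backwardCluster`),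
  `IsTightChain` (tight anchored causal chain of `K` links through TRUE space-time points), the halo
  margin `haloMargin`, the counts `hotBadCount`, `chainCount`;
* § 3 cap schedules `AdmissibleCap`, `AdmissibleGathering` and their genuineness `TrueCapTail`,
  `ForecastGatheringTail`;
* § 4 the seven registered stub STATEMENTS `ForecastWorldsGood`, `EnergyDomination`, `AnchoredCovering`,
  `TrueCapsExist`, `ForecastCapsExist`, `TightChainPressure`, `HotResidualPressure`, and the
  eventual-in-`R` form `InfluenceLocalityEventually` of the crux that their composition yields.

Units: `ℓ = (N+1)^{-1/3}`; the range `R`, the halo margin `D` and the diameter `σ` are in `ℓ`-units,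
the horizon is `Tℓ`; speeds are absolute (`N`-independent, thermal scale `√θ`) and caps are RELATIVE to
the drift `u₀`. The statements are those registered by `ledger skeleton check` (2026-08-16); see the
line card `Cruxes/InfluenceLocality/Lines/true-anchored-infection.md` for their status (stubs 1–3
null-set / deterministic, 4 true-side Rice tail, 5 forecast cardinality tail = `G_free`, 6 the XL
true-side LD core, 7 the contested hot-sector residual of the typed `∀ lam` form). Nothing is proved
here beyond bookkeeping (`influenceLocality_iff`, `badCount_eq`, `hotBadCount_le_badCount`,
`badCount_le`).
-/

namespace Summit.AtomisticToContinuum.HydrodynamicLimit.Theorems.TrueAnchoredInfection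

open MeasureTheory Set
open scoped Classical ENNReal
open Literature.Analysis.FluidPDE Literature.MathematicalPhysics.KineticTheory
open Summit.AtomisticToContinuum.HydrodynamicLimit.Theses.AntiMazurCoboundaries (InfluenceLocality)

noncomputable section

/-! ## The objects of the crux (verbatim read-back) -/

/-- The microscopic length unit `ℓ_N = (N+1)^{-1/3}`. -/
abbrev ell (N : ℕ) : ℝ := ((N + 1 : ℕ) : ℝ) ^ (-(1 / 3 : ℝ))

/-- The torus geometry of the crux. -/
abbrev G3 : Geometry (Fin 3) T3 := Torus.geometry (Fin 3)

/-- The true flows of the crux: `N + 1` spheres of diameter `σℓ` on `𝕋³`. -/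
abbrev Flow (σ : ℝ) (N : ℕ) : Type := HardSphereFlow G3 (hsDiameter σ N) (N + 1)

/-- The cluster-flow families of the crux (same diameter, every particle number). -/
abbrev ClusterFlows (σ : ℝ) (N : ℕ) : Type := (k : ℕ) → HardSphereFlow G3 (hsDiameter σ N) k

/-- Phase space of the `N + 1` true particles. -/
abbrev Phase (N : ℕ) : Type := Config (N + 1) (Fin 3) T3

/-- Particle `i` is BAD at range `Rℓ` on `[0, Tℓ]` (verbatim the crux's predicate). -/
def IsBad (σ T R : ℝ) (N : ℕ) (Φ : Flow σ N) (Ψ : ClusterFlows σ N) (z : Phase N)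
    (i : Fin (N + 1)) : Prop :=
  ∃ t ∈ Set.Icc (0 : ℝ) (T * ell N), Φ.flow t z i ≠ localClusterState Ψ (R * ell N) t z i

/-- `#bad` (verbatim the `Finset.card` of the crux). -/
def badCount (σ T R : ℝ) (N : ℕ) (Φ : Flow σ N) (Ψ : ClusterFlows σ N) (z : Phase N) : ℕ :=
  (Finset.univ.filter fun i : Fin (N + 1) => ∃ t ∈ Set.Icc (0 : ℝ) (T * ell N),
      Φ.flow t z i ≠ localClusterState Ψ (R * ell N) t z i).card

/-- `G_N`: the global Gibbs law with constant profiles (verbatim the measure of the crux). -/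
def gibbs (σ a θ : ℝ) (u₀ : V3) (N : ℕ) (Φ : Flow σ N) : Measure (Phase N) :=
  localGibbsLaw σ (fun _ => a) (fun _ => u₀) (fun _ => θ) N Φ

/-- The innermost inequality of the crux at fixed parameters. -/
def Bound (a θ : ℝ) (u₀ : V3) (σ T lam δ R : ℝ) (N : ℕ) (Φ : Flow σ N) (Ψ : ClusterFlows σ N) :
    Prop :=
  ∫⁻ z, ENNReal.ofReal (Real.exp (lam * (badCount σ T R N Φ Ψ z : ℝ))) ∂(gibbs σ a θ u₀ N Φ)
    ≤ ENNReal.ofReal (Real.exp (δ * (N + 1)))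

/-- READ-BACK: the crux is, by `Iff.rfl`, the quantifier shell around `Bound`. -/
theorem influenceLocality_iff :
    InfluenceLocality ↔ ∀ (a θ : ℝ) (u₀ : V3), 0 < a → 0 < θ → ∃ σ₀ : ℝ, 0 < σ₀ ∧ ∀ σ : ℝ,
      0 < σ → σ < σ₀ → ∀ (T lam δ : ℝ), 0 < T → 0 < lam → 0 < δ → ∃ R : ℝ, 0 < R ∧ ∃ N₀ : ℕ,
      ∀ N : ℕ, N₀ ≤ N → ∀ (Φ : Flow σ N) (Ψ : ClusterFlows σ N), Bound a θ u₀ σ T lam δ R N Φ Ψ :=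
  Iff.rfl

/-! ## The events of the line

All events below are indexed by GRID TIMES `Tℓ·q`, `q ∈ ℚ ∩ [0, 1]`: on good orbits positions
are continuous and velocities right-continuous, so nothing is lost (this rationalisation is
part of `stub_anchoredCovering`), and every event is a countable union of preimages of
measurable sets under the time-`t` maps of the flows. Velocity caps are relative to the drift
`u₀` of `G_N`; positions are compared at different times, so the chain speed below is the
absolute one (`w + ‖u₀‖`). -/

/-- HOT (true side): some TRUE particle has relative speed `> u` at a grid time at which it
lies within `R'ℓ` (minimal-image distance) of the initial position of `i`. -/
def IsHot (σ T : ℝ) (N : ℕ) (Φ : Flow σ N) (u₀ : V3) (u R' : ℝ) (z : Phase N)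
    (i : Fin (N + 1)) : Prop :=
  ∃ (j : Fin (N + 1)) (q : ℚ), 0 ≤ q ∧ q ≤ 1 ∧
    u < ‖(Φ.flow (T * ell N * q) z j).2 - u₀‖ ∧
    Torus.euclidDist (Φ.flow (T * ell N * q) z j).1 (z i).1 < R' * ell N

/-- The FORECAST WORLD of particle `i` at range `Rℓ`: the isolated hard-sphere evolution
`Ψ k` of its range cluster (`k` = cluster size), as a curve in `k`-particle phase space. On the
good set of `Ψ k` its `i`-th member is `localClusterState Ψ (Rℓ) · z i`
(`clusterStateIn_of_mem_good`); off it the values are junk (a `G_N`-null event,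
`stub_forecastWorldsGood`). -/
def forecastWorld (σ R : ℝ) (N : ℕ) (Ψ : ClusterFlows σ N) (z : Phase N) (i : Fin (N + 1)) :
    ℝ → Config (rangeCluster G3 (R * ell N) z i).card (Fin 3) T3 :=
  fun t => (Ψ (rangeCluster G3 (R * ell N) z i).card).flow t
    (Config.restrictTo (rangeCluster G3 (R * ell N) z i) z)

/-- FORECAST-HOT: some particle of the forecast world of `i` has relative speed `> w` at a grid
time. -/
def IsForecastHot (σ T R : ℝ) (N : ℕ) (Ψ : ClusterFlows σ N) (u₀ : V3) (w : ℝ) (z : Phase N)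
    (i : Fin (N + 1)) : Prop :=
  ∃ (m : Fin (rangeCluster G3 (R * ell N) z i).card) (q : ℚ), 0 ≤ q ∧ q ≤ 1 ∧
    w < ‖(forecastWorld σ R N Ψ z i (T * ell N * q) m).2 - u₀‖

/-- GATHERING (forecast side): at some grid time some particle of the forecast world of `i`
has, together with its backward cluster over `(0, t]` IN THE FORECAST DYNAMICS
(`KineticTheory.backwardCluster`), more than `M` members — the only way a forecast particle
can carry more than `M` initial (= true) kinetic energies (`stub_energyDomination`). -/
def IsGathering (σ T R : ℝ) (N : ℕ) (Ψ : ClusterFlows σ N) (M : ℕ) (z : Phase N)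
    (i : Fin (N + 1)) : Prop :=
  ∃ (m : Fin (rangeCluster G3 (R * ell N) z i).card) (q : ℚ), 0 ≤ q ∧ q ≤ 1 ∧
    M < (insert m (backwardCluster G3 (hsDiameter σ N) (forecastWorld σ R N Ψ z i) m 0
      (T * ell N * q))).card

/-- TIGHT ANCHORED CHAIN of `K` links ending at `i`: `K + 1` DISTINCT true particles
`j 0, …, j K = i` and non-decreasing grid times `q 0 ≤ ⋯ ≤ q K` in `[0, 1]` such that
consecutive TRUE space-time points obey the causal step bound
`dist(x_{j(m+1)}(Tℓ q(m+1)), x_{j m}(Tℓ q m)) ≤ σℓ (1 + 1/(K+1)) + w · Tℓ (q(m+1) − q m)`: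
one diameter per link (plus a rationalisation slack of total size `≤ σℓ`, vanishing per link as
`K → ∞` — a fixed slack would admit static loose necklaces at bounded cost per link) and
`w`-causal in between (`w` an ABSOLUTE speed). The shadow on the TRUE flow of an infection
lineage whose carriers are capped in both worlds (anchoring). Antitone in `K` along suffixes. -/
def IsTightChain (σ T : ℝ) (N : ℕ) (Φ : Flow σ N) (w : ℝ) (K : ℕ) (z : Phase N)
    (i : Fin (N + 1)) : Prop :=
  ∃ (j : Fin (K + 1) → Fin (N + 1)) (q : Fin (K + 1) → ℚ),
    Function.Injective j ∧ j (Fin.last K) = i ∧ Monotone q ∧ (∀ m, 0 ≤ q m ∧ q m ≤ 1) ∧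
    ∀ m : Fin K,
      Torus.euclidDist (Φ.flow (T * ell N * q m.succ) z (j m.succ)).1
          (Φ.flow (T * ell N * q m.castSucc) z (j m.castSucc)).1
        ≤ hsDiameter σ N * (1 + 1 / (K + 1)) + w * (T * ell N * (q m.succ - q m.castSucc))

/-- The HALO MARGIN `D = (u + ‖u₀‖) T + 2σ` (in `ℓ`-units): a true carrier with relative cap
`u`, or an outsider root one diameter away from it, stays within `(R + D)ℓ` of `x_i(0)` on the
window. -/
def haloMargin (u₀ : V3) (σ T u : ℝ) : ℝ := (u + ‖u₀‖) * T + 2 * σ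

/-- `#hotBad`: bad particles whose halo of radius `(R + D)ℓ` is visited by a true particle of
relative speed `> u`, or whose forecast world gathers more than `M` particles. -/
def hotBadCount (σ T R : ℝ) (N : ℕ) (Φ : Flow σ N) (Ψ : ClusterFlows σ N) (u₀ : V3) (u D : ℝ)
    (M : ℕ) (z : Phase N) : ℕ :=
  (Finset.univ.filter fun i : Fin (N + 1) => IsBad σ T R N Φ Ψ z i ∧
      (IsHot σ T N Φ u₀ u (R + D) z i ∨ IsGathering σ T R N Ψ M z i)).card

/-- `#chainEnd`: particles at which a tight anchored `w`-chain of `K` links ends. -/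
def chainCount (σ T : ℝ) (N : ℕ) (Φ : Flow σ N) (w : ℝ) (K : ℕ) (z : Phase N) : ℕ :=
  (Finset.univ.filter fun i : Fin (N + 1) => IsTightChain σ T N Φ w K z i).card

/-! ## Cap schedules -/

/-- ADMISSIBLE speed-cap schedule `u(R)` (relative cap, prover's choice): eventually positive
and `u(R)² ≤ θ√R` — room for the natural `u(R)² = 2θ(4 log R + C)`, small enough that
`u√M`-causal chains of `≍ R/σ` links still fit in range `R`. -/
def AdmissibleCap (θ : ℝ) (u : ℝ → ℝ) : Prop :=
  ∃ Rₐ : ℝ, 0 < Rₐ ∧ ∀ R : ℝ, Rₐ ≤ R → 0 < u R ∧ u R ^ 2 ≤ θ * Real.sqrt R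

/-- ADMISSIBLE gathering-threshold schedule `M(R)`: eventually `1 ≤ M(R) ≤ √R` — room for the
natural polylogarithmic `M(R)`. -/
def AdmissibleGathering (M : ℝ → ℕ) : Prop :=
  ∃ Rₐ : ℝ, 0 < Rₐ ∧ ∀ R : ℝ, Rₐ ≤ R → 1 ≤ M R ∧ (M R : ℝ) ≤ Real.sqrt R

/-- The cap `u(R)` is GENUINE (true side): uniformly in the particle and in `N ≥ N₀(R)`, the
`G_N`-probability that some true particle is faster than `u(R)` (relative to `u₀`) while in the
halo `B(x_i(0), (R + D(R))ℓ)` during `[0, Tℓ]` tends to `0` as `R → ∞`. Content: stationarity of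
`G_N` + the equilibrium collision-flux (Rice) identity, Maxwellian tail `poly(R)·u²e^{−u²/2θ}`. -/
def TrueCapTail (σ a θ : ℝ) (u₀ : V3) (T : ℝ) (u : ℝ → ℝ) : Prop :=
  ∀ η : ℝ, 0 < η → ∃ R₀ : ℝ, 0 < R₀ ∧ ∀ R : ℝ, R₀ ≤ R → ∃ N₀ : ℕ, ∀ N : ℕ, N₀ ≤ N →
    ∀ (Φ : Flow σ N) (i : Fin (N + 1)),
      gibbs σ a θ u₀ N Φ {z | IsHot σ T N Φ u₀ (u R) (R + haloMargin u₀ σ T (u R)) z i}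
        ≤ ENNReal.ofReal η

/-- The threshold `M(R)` is GENUINE (forecast side): uniformly in `i`, `N ≥ N₀(R)` and the
cluster flows, the `G_N`-probability that the forecast world of `i` gathers more than `M(R)`
particles within `[0, Tℓ]` tends to `0` as `R → ∞` — a backward-cluster CARDINALITY tail for a
Gibbs cluster of `≍ R³` spheres released into vacuum for the microscopic time `Tℓ` (union over
the cluster; `G_free` of TRIAGE-r1-2 §0 F2 in the form "E1 + cardinality tail"). -/
def ForecastGatheringTail (σ a θ : ℝ) (u₀ : V3) (T : ℝ) (M : ℝ → ℕ) : Prop :=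
  ∀ η : ℝ, 0 < η → ∃ R₀ : ℝ, 0 < R₀ ∧ ∀ R : ℝ, R₀ ≤ R → ∃ N₀ : ℕ, ∀ N : ℕ, N₀ ≤ N →
    ∀ (Φ : Flow σ N) (Ψ : ClusterFlows σ N) (i : Fin (N + 1)),
      gibbs σ a θ u₀ N Φ {z | IsGathering σ T R N Ψ (M R) z i} ≤ ENNReal.ofReal η

/-! ## The stub statements -/

/-- STUB 1 (null sets; M): `G_N`-almost every datum is good for the true flow AND every one of
its `N + 1` range clusters restricts to a good datum of the cluster flow (so forecast worlds are
genuine hard-sphere trajectories and `localClusterState` is their evaluation). Content: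
`G_N = Liouville.withDensity` (`particleLaw_eq`), a sub-configuration of a non-overlapping
configuration is non-overlapping, the preimage of the Liouville-null `(Ψ k).goodᶜ` under the
coordinate projection `Config.restrictTo S` is null (Fubini), union over the finitely many `S`. -/
def ForecastWorldsGood : Prop :=
  ∀ (σ a θ : ℝ) (u₀ : V3) (N : ℕ) (Φ : Flow σ N) (Ψ : ClusterFlows σ N) (R : ℝ),
    0 < σ → σ ≤ 1 / 2 → 0 < a → 0 < θ →
    ∀ᵐ z ∂(gibbs σ a θ u₀ N Φ), z ∈ Φ.good ∧
      ∀ i : Fin (N + 1), Config.restrictTo (rangeCluster G3 (R * ell N) z i) z ∈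
        (Ψ (rangeCluster G3 (R * ell N) z i).card).good

/-- STUB 2 (lever (ii), ENERGY DOMINATION; M): along any hard-sphere trajectory on `𝕋³` and for
any reference velocity `c`, the kinetic energy of a particle relative to `c` at time `t ≥ 0` is
at most the INITIAL relative kinetic energy of itself plus its backward cluster over `(0, t]`.
Proof sketch (E1 of the card, iterated): order the members `a` of `C = {m} ∪ BC` by the time
`τ_a` at which they join the backward sweep (`τ_m = t`); every collision of `a` at a time
`≤ τ_a` has its partner in `C` and still active, so `s ↦ Σ_{a ∈ C, τ_a ≥ s} ‖v_a(s) − c‖²` is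
non-increasing (pair collisions conserve `Σ v` and `Σ ‖v‖²`, hence `Σ ‖v − c‖²`; members only
leave); at `s = t` it dominates `‖v_m(t) − c‖²`, at `s = 0` it is the right-hand side. -/
def EnergyDomination : Prop :=
  ∀ (k : ℕ) (ε : ℝ) (γ : ℝ → Config k (Fin 3) T3), IsHardSphereTrajectory G3 ε k γ →
    ∀ (c : V3) (m : Fin k) (t : ℝ), 0 ≤ t →
      ‖(γ t m).2 - c‖ ^ 2 ≤ ∑ a ∈ insert m (backwardCluster G3 ε γ m 0 t), ‖(γ 0 a).2 - c‖ ^ 2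

/-- STUB 3 (lever (i), ANCHORED COVERING; L): for `G_N`-a.e. datum and every particle `i`, if
`i` is bad at range `R` on `[0, Tℓ]`, no true particle has relative speed `> u` while within
`(R + D)ℓ` of `x_i(0)` and no particle of the forecast world of `i` ever has relative speed `> w`
(`u ≤ w`), then a tight anchored chain of `K` links with absolute speed `w + ‖u₀‖` ends at `i`,
for every `K` with `(K + 2)σ + (u + w + 2‖u₀‖)T ≤ R` and halo margin `D ≥ (u + ‖u₀‖)T + 2σ`.
Proof sketch: trace the first-infection lineage of `i` back to its last outsider contact (root
`o`, initially farther than `Rℓ`; inside the halo it is capped); every link is a contact, in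
`Φ` or in the forecast world, between an infected carrier and a fresh receiver whose two states
still coincide, so it sits at the receiver's TRUE position, one diameter from a carrier that
moved at absolute speed `≤ w + ‖u₀‖` since ITS infection point (anchoring); infection times
strictly increase (a tie would be a non-binary collision in one world); the lineage spans
`≥ (R − (u + ‖u₀‖)T)ℓ` in total time `≤ Tℓ`, forcing `≥ K + 2` links; keep the last `K` (root
excluded), round the times UP to grid times so close that positions move by `≤ σℓ/(2(K+1))`.
Null sets: `stub_forecastWorldsGood`, binary collisions (`IsHardSphereTrajectory.binary`) in
both worlds, forward uniqueness (`IsHardSphereTrajectory.unique_holds`) for "no diverging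
contact ⇒ no infection", local finiteness for "states differ AT the infection time". -/
def AnchoredCovering : Prop :=
  ∀ (σ a θ : ℝ) (u₀ : V3) (N : ℕ) (Φ : Flow σ N) (Ψ : ClusterFlows σ N)
    (T R u w D : ℝ) (K : ℕ),
    0 < σ → σ ≤ 1 / 2 → 0 < a → 0 < θ → 0 ≤ T → 0 < u → u ≤ w →
    (u + ‖u₀‖) * T + 2 * σ ≤ D → ((K : ℝ) + 2) * σ + (u + w + 2 * ‖u₀‖) * T ≤ R →
    ∀ᵐ z ∂(gibbs σ a θ u₀ N Φ), ∀ i : Fin (N + 1),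
      IsBad σ T R N Φ Ψ z i → ¬ IsHot σ T N Φ u₀ u (R + D) z i →
        ¬ IsForecastHot σ T R N Ψ u₀ w z i → IsTightChain σ T N Φ (w + ‖u₀‖) K z i

/-- STUB 4 (TRUE CAPS EXIST; M–L): for every horizon there is an admissible genuine speed-cap
schedule (`u(R)² = 2θ(4 log R + log(1 + T/t_mf) + C)` does it: `(R + D + v̄T)³` candidate
particles, each `u`-fast at some time of `[0, Tℓ]` with `G_N`-probability
`≤ (1 + cσ²T) C u² e^{−u²/2θ}` by stationarity (`measurePreserving_flow_localGibbsLaw`) and the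
equilibrium collision-flux identity; the route's "Monday-morning (2)" estimate, CIP1994 §2,
Spohn1991 I.3). -/
def TrueCapsExist : Prop :=
  ∀ (a θ : ℝ) (u₀ : V3), 0 < a → 0 < θ → ∃ σ₀ : ℝ, 0 < σ₀ ∧ ∀ σ : ℝ, 0 < σ → σ < σ₀ →
    ∀ T : ℝ, 0 < T → ∃ u : ℝ → ℝ, AdmissibleCap θ u ∧ TrueCapTail σ a θ u₀ T u

/-- STUB 5 (FORECAST CAPS EXIST = `G_free`; L–XL): for every horizon there is an admissible
genuine gathering-threshold schedule (`M(R) = (C log R)^{C'(1+T/t_mf)}` should do: union over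
the `≍ R³` cluster members of a backward-cluster cardinality tail of Pulvirenti–Simonella type,
`P(|BC| ≥ k) ≤ C^t e^{−¼ k^{1/(Ct)}}` — in print only in the Boltzmann–Grad limit
(PulvirentiSimonella2021 Thm 2.1, AokiPulvirentiSimonellaTsuji2015), and here for the ISOLATED
cluster released from Gibbs data (not stationary: TRIAGE-r1-3 note B; one Lanford window is
available via the released-ball identity, TRIAGE-r1-3 on `released-ball-conditioned-equilibrium`;
a WALLED re-typing of the forecast makes it the true-side estimate). -/
def ForecastCapsExist : Prop :=
  ∀ (a θ : ℝ) (u₀ : V3), 0 < a → 0 < θ → ∃ σ₀ : ℝ, 0 < σ₀ ∧ ∀ σ : ℝ, 0 < σ → σ < σ₀ →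
    ∀ T : ℝ, 0 < T → ∃ M : ℝ → ℕ, AdmissibleGathering M ∧ ForecastGatheringTail σ a θ u₀ T M

/-- STUB 6 (TIGHT-CHAIN PRESSURE, the ordered half on the TRUE side; XL): under the stationary
law `G_N` the number of particles at which a tight anchored `w`-chain of `K` links ends has
exponential moment `≤ e^{δ(N+1)}` at any rate `lam`, once `K ≥ C(1 + w)` with
`C = C(σ, T, lam, δ)`, uniformly in `N ≥ N₀`. Heuristic: a chain of `K` links within time `Tℓ`
has total spatial slack `≤ (σ + wT)ℓ`, so its typical link is a static near-contact at gap
`≲ (σ + wT)ℓ/K`, of `G_N`-cost `≈ log(K/(4πσ²(σ + wT)))` per link and per endpoint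
(near-jammed rows, relay rows: Disproof item 4(b), `R` exponential in `lam`; hence `K₀` AFFINE in
`w`); stationarity (`measurePreserving_flow_localGibbsLaw`) moves every grid-time configuration
to time `0`; the multi-time correlation is the card `seamed-lineage-depth` /
`slab-percolation-shadow` engine; the sum over endpoints needs a chessboard / cluster-expansion
decoupling at small `σ`. NO cluster flow `Ψ` in the statement (the payoff of anchoring). -/
def TightChainPressure : Prop :=
  ∀ (a θ : ℝ) (u₀ : V3), 0 < a → 0 < θ → ∃ σ₀ : ℝ, 0 < σ₀ ∧ ∀ σ : ℝ, 0 < σ → σ < σ₀ →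
    ∀ (T lam δ : ℝ), 0 < T → 0 < lam → 0 < δ → ∃ C : ℝ, 0 < C ∧ ∀ w : ℝ, 0 < w →
      ∀ K : ℕ, C * (1 + w) ≤ K → ∃ N₀ : ℕ, ∀ N : ℕ, N₀ ≤ N → ∀ (Φ : Flow σ N),
        ∫⁻ z, ENNReal.ofReal (Real.exp (lam * (chainCount σ T N Φ w K z : ℝ))) ∂(gibbs σ a θ u₀ N Φ)
          ≤ ENNReal.ofReal (Real.exp (δ * (N + 1)))

/-- STUB 7 (HOT RESIDUAL PRESSURE, the typed-form residual; eventual-in-`R` shape of Disproof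
§D): for every PAIR OF GENUINE ADMISSIBLE CAP SCHEDULES `u(R), M(R)`, the number of bad particles
whose halo `(R + D(R))ℓ` is visited by a true particle of relative speed `> u(R)` or whose
forecast world gathers more than `M(R)` particles has exponential moment `≤ e^{δ(N+1)}` for all
large `R`, uniformly in `N ≥ N₀(R)`. IMPLIED by the eventual form of the crux
(`hotResidual_of_eventually`). Restricted to genuine caps, so the hot-bad particles are a rare
sub-population and the statement is NOT the crux in costume (with a non-genuine cap, e.g.
`u ≡ 0⁺` or `M ≡ 1`, every bad particle would be hot-bad). CONTESTED: the triage panel's steered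
dispersal family (one far intruder of energy `E`, cost `E/θ + R/λ'`, fragmented into `≍ κ_th E/θ`
corrupted forecasts, every one of them hot-bad for any admissible cap) gives this count a cost
per particle bounded in `R` (`≈ 1/κ_th(T,σ)`), so the bound is expected to FAIL for
`lam > lam_c(T,σ)` (TRIAGE-r1-3 note A; `SteeredDispersalCascades.md` §1–2 argues "true only
beyond a tower in `R`"). Either way it is exactly as strong as the hot sector of the typed
crux; at probability level its content is just `TrueCapTail` + `ForecastGatheringTail`. -/
def HotResidualPressure : Prop :=
  ∀ (a θ : ℝ) (u₀ : V3), 0 < a → 0 < θ → ∃ σ₀ : ℝ, 0 < σ₀ ∧ ∀ σ : ℝ, 0 < σ → σ < σ₀ →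
    ∀ (T lam δ : ℝ), 0 < T → 0 < lam → 0 < δ → ∀ (u : ℝ → ℝ) (M : ℝ → ℕ),
      AdmissibleCap θ u → AdmissibleGathering M →
      TrueCapTail σ a θ u₀ T u → ForecastGatheringTail σ a θ u₀ T M →
      ∃ R₀ : ℝ, 0 < R₀ ∧ ∀ R : ℝ, R₀ ≤ R → ∃ N₀ : ℕ, ∀ N : ℕ, N₀ ≤ N →
        ∀ (Φ : Flow σ N) (Ψ : ClusterFlows σ N),
          ∫⁻ z, ENNReal.ofReal (Real.exp (lam *
              (hotBadCount σ T R N Φ Ψ u₀ (u R) (haloMargin u₀ σ T (u R)) (M R) z : ℝ)))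
              ∂(gibbs σ a θ u₀ N Φ)
            ≤ ENNReal.ofReal (Real.exp (δ * (N + 1)))


/-! ## Eventual form and elementary bookkeeping -/

/-- EVENTUAL-IN-`R` form of the crux (`∃ R₀ ∀ R ≥ R₀`; Disproof.lean §D — the shape the
consumer stmt-13917 actually uses). The stubs give this stronger form (`eventually_of_stubs`);
the crux follows by taking `R = R₀` (`InfluenceLocality_of`). -/
def InfluenceLocalityEventually : Prop :=
  ∀ (a θ : ℝ) (u₀ : V3), 0 < a → 0 < θ → ∃ σ₀ : ℝ, 0 < σ₀ ∧ ∀ σ : ℝ, 0 < σ → σ < σ₀ →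
    ∀ (T lam δ : ℝ), 0 < T → 0 < lam → 0 < δ → ∃ R₀ : ℝ, 0 < R₀ ∧ ∀ R : ℝ, R₀ ≤ R →
    ∃ N₀ : ℕ, ∀ N : ℕ, N₀ ≤ N → ∀ (Φ : Flow σ N) (Ψ : ClusterFlows σ N),
    Bound a θ u₀ σ T lam δ R N Φ Ψ

/-- `#bad` is the number of particles satisfying `IsBad`. -/
theorem badCount_eq (σ T R : ℝ) (N : ℕ) (Φ : Flow σ N) (Ψ : ClusterFlows σ N) (z : Phase N) :
    badCount σ T R N Φ Ψ z = (Finset.univ.filter fun i => IsBad σ T R N Φ Ψ z i).card := rfl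

/-- At most all `N + 1` spheres are bad. -/
theorem badCount_le (σ T R : ℝ) (N : ℕ) (Φ : Flow σ N) (Ψ : ClusterFlows σ N) (z : Phase N) :
    badCount σ T R N Φ Ψ z ≤ N + 1 := by
  rw [badCount_eq]
  calc _ ≤ Finset.univ.card := Finset.card_filter_le _ _
    _ = N + 1 := by simp

/-- The hot-bad count never exceeds the bad count. -/
theorem hotBadCount_le_badCount (σ T R : ℝ) (N : ℕ) (Φ : Flow σ N) (Ψ : ClusterFlows σ N)
    (u₀ : V3) (u D : ℝ) (M : ℕ) (z : Phase N) :
    hotBadCount σ T R N Φ Ψ u₀ u D M z ≤ badCount σ T R N Φ Ψ z := by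
  rw [badCount_eq, hotBadCount]
  exact Finset.card_le_card (Finset.monotone_filter_right _ fun i _ h => h.1)

/-- The eventual form implies the crux (take `R = R₀`). The converse is NOT formal (badness is not
monotone in `R`, Disproof.lean §D). -/
theorem influenceLocality_of_eventually (h : InfluenceLocalityEventually) : InfluenceLocality := by
  rw [influenceLocality_iff]
  intro a θ u₀ ha hθ
  obtain ⟨σ₀, hσ₀, hσ⟩ := h a θ u₀ ha hθ
  refine ⟨σ₀, hσ₀, fun σ hs hs' T lam δ hT hlam hδ => ?_⟩
  obtain ⟨R₀, hR₀, hR⟩ := hσ σ hs hs' T lam δ hT hlam hδ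
  obtain ⟨N₀, hN⟩ := hR R₀ le_rfl
  exact ⟨R₀, hR₀, N₀, hN⟩

/-! ## The registered bookkeeping stub S0 -/

/-- **Registered stub S0 `stub_objects`** of the line `true-anchored-infection`
(crux stmt-AtomisticToContinuum-13916): (i) the eventual-in-`R` form implies the crux by name;
(ii) the counting facts `#hotBad ≤ #bad ≤ N + 1`. -/
theorem stub_objects : (InfluenceLocalityEventually → InfluenceLocality) ∧ ∀ (σ T R : ℝ) (N : ℕ) (Φ : Flow σ N) (Ψ : ClusterFlows σ N) (u₀ : V3) (u D : ℝ) (M : ℕ) (z : Phase N), hotBadCount σ T R N Φ Ψ u₀ u D M z ≤ badCount σ T R N Φ Ψ z ∧ badCount σ T R N Φ Ψ z ≤ N + 1 :=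
  ⟨influenceLocality_of_eventually, fun σ T R N Φ Ψ u₀ u D M z =>
    ⟨hotBadCount_le_badCount σ T R N Φ Ψ u₀ u D M z, badCount_le σ T R N Φ Ψ z⟩⟩

end

end Summit.AtomisticToContinuum.HydrodynamicLimit.Theorems.TrueAnchoredInfection
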